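import Mathlib
import Summits.NavierStokesRegularity.NavierStokesRegularity.Theorems.LerayQuarterDissipationFiniteDissipationLiouvilleMixedRegion
import HarnessLib

/-!
# Crux `FiniteDissipationLiouville` (stmt-NavierStokesRegularity-22144): the MIXED `(C, K)` region —
# explicit points of the lens (file 2/2)

Theorems file of route `LerayQuarterDissipation` (lead prover g17; `--supports` the crux; sequel of
`…MixedRegion`). Navier–Stokes regularity is NOT proved by anything here; no summit is.

`𝒟_{C,K}`: Type-I ancient mild fields `V` in the KNSS gauge (`IsTypeIAncientMild C V`) with Leray's
quarter-rate law `∫‖DV(t)‖² ≤ K/√(−t)`; `θ(K) = √(max K 0)·(√K_S)³` (`K_S` Mathlib's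
Gagliardo–Nirenberg–Sobolev constant). `…MixedRegion.eq_zero_of_mixed` kills every member with
`2λμ + (1−λ)·3(1+δ)/(2κ) ≤ 2` and `λC²/μ + (1−λ)κ³θ⁴ < 1` for some `0 ≤ λ ≤ 1`, `μ, κ, δ > 0`. Here:

* **`eq_zero_of_typeI_le_one_of_theta_four_lt_four` — AT THRESHOLD ONE THE DISSIPATION THRESHOLD IS
  `4`, NOT `64/27`: every member with `C ≤ 1` and `θ(K)⁴ < 4` vanishes identically** (closed form:
  `κ = ½`, `λ = 1 − g/8`, `δ = g/6`, `μ = (2 − 3λ'(1+δ))/(2λ)` with `λ' = g/8`, `g = 1 − θ⁴/4`) — at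
  `C = 1` the admissible dissipation constant `K` grows by the factor `3√3/4 ≈ 1.299`, explicitly
  and with `V ≡ 0` outright, where `…ThresholdOne` had an ineffective collar and
  `…VorticityAmplitudeJoint` needed `C_ω < √3/2`;
* `eq_zero_of_typeI_le_of_theta_four_le₁`, `…₂` — two explicit points with `C > 1` AND `θ⁴ > 64/27`
  (inside NEITHER strip of the tree): `C ≤ 21/20 ∧ θ⁴ ≤ 5/2` and `C ≤ 11/10 ∧ θ⁴ ≤ 12/5` force
  `V ≡ 0` (rational parameters, checked by `norm_num`);
* `not_singular_of_explicit_region₂` — the explicit proved region of the crux, enlarged: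
  `{C ≤ 1 ∧ θ⁴ < 4} ∪ {θ⁴ < 64/27} ∪ {C ≤ 21/20 ∧ θ⁴ ≤ 5/2} ∪ {C ≤ 11/10 ∧ θ⁴ ≤ 12/5}` (compare
  `…ProvedRegion.not_singular_of_explicit_region`: `C ≤ 1 ∨ θ⁴ < 64/27`).

HONEST FRAMING. Explicit necessary conditions on the HYPOTHETICAL singular profile; sample points of
a thin lens (`1 ≤ C < 2/√3`, `64/27 ≤ θ⁴ < 4`), none claimed optimal; Mathlib's `K_S` is not the
sharp Sobolev constant. Nothing is removed from the catalogued DSS wall (`∀ c > 1, TypeIDSSLiouville c`,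
NECESSARY for the crux); the verdict of the line is unchanged (FRONTIER). Nothing here bears on
Navier–Stokes regularity or blow-up.

References: Koch–Nadirashvili–Seregin–Šverák, Acta Math. 203 (2009) §4; folklore energy method.
-/

noncomputable section

set_option linter.dupNamespace false

namespace Summit.NavierStokesRegularity.NavierStokesRegularity.Theorems.FiniteDissipationLiouville.MixedRegion

open MeasureTheory Set Filter Topology Metric InnerProductSpace Function Real
open scoped RealInnerProductSpace ContDiff ENNReal Laplacian
open Literature.Analysis Literature.Analysis.FluidPDE
open Summit.NavierStokesRegularity.NavierStokesRegularity.Theorems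
open Summit.NavierStokesRegularity.NavierStokesRegularity.Theorems.GaussianGap
open Summit.NavierStokesRegularity.NavierStokesRegularity.Theorems.SimilarityEnstrophy
open Summit.NavierStokesRegularity.NavierStokesRegularity.Theorems.SmallDissipationGap

variable {C : ℝ} {V : ℝ → (EuclideanSpace ℝ (Fin 3)) → (EuclideanSpace ℝ (Fin 3))}

/-! ### Explicit points of the lens -/

section Explicit

/-- **AT THRESHOLD ONE THE DISSIPATION THRESHOLD IS `4`.** A member of `𝒟_{C,K}` with `C ≤ 1` and
`θ(K)⁴ = (√(max K 0)·(√K_S)³)⁴ < 4` vanishes identically on `t < 0` (closed form of the mixed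
theorem: `κ = ½`, `λ = 1 − g/8`, `δ = g/6`, `μ = (2 − 3(g/8)(1+δ))/(2(1 − g/8))`, `g = 1 − θ⁴/4`).
Compare the tree: `C < 1` any `K` (T31⁗); `θ⁴ < 64/27` any `C`; `C ≤ 1` not singular by
compactness (`…ThresholdOne`); `C ≤ 1 ∧ C_ω < √3/2 ⇒ V ≡ 0` (`…VorticityAmplitudeJoint`). Here the
admissible `θ⁴` at `C ≤ 1` grows from `64/27 ≈ 2.37` to `4`, i.e. the dissipation constant `K` by
the factor `3√3/4 ≈ 1.299`, EXPLICITLY and with `V ≡ 0` outright. [folklore energy method] -/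
theorem eq_zero_of_typeI_le_one_of_theta_four_lt_four (hV : IsTypeIAncientMild C V) (hC1 : C ≤ 1)
    {K : ℝ}
    (hK : ∀ t : ℝ, t < 0 → ∫⁻ x, ‖fderiv ℝ (V t) x‖ₑ ^ 2 ≤ ENNReal.ofReal (K / Real.sqrt (-t)))
    (hθ : (Real.sqrt (max K 0) * Real.sqrt (SNormLESNormFDerivOfEqConst (EuclideanSpace ℝ (Fin 3))
          (volume : Measure (EuclideanSpace ℝ (Fin 3))) 2 : ℝ) ^ 3) ^ 4 < 4) :
    ∀ t < 0, ∀ x, V t x = 0 := by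
  have hC : 0 ≤ C := hV.nonneg
  set T : ℝ := (Real.sqrt (max K 0) * Real.sqrt (SNormLESNormFDerivOfEqConst (EuclideanSpace ℝ (Fin 3))
          (volume : Measure (EuclideanSpace ℝ (Fin 3))) 2 : ℝ) ^ 3) ^ 4 with hTdef
  have hT0 : 0 ≤ T := by positivity
  set g : ℝ := 1 - T / 4 with hg
  have hgpos : 0 < g := by rw [hg]; linarith
  have hg1 : g ≤ 1 := by rw [hg]; linarith
  set ε : ℝ := g / 8 with hε
  set δ : ℝ := g / 6 with hδ
  have hεpos : 0 < ε := by positivity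
  have hδpos : 0 < δ := by positivity
  have hε1 : ε ≤ 1 / 8 := by rw [hε]; linarith
  set p : ℝ := 3 * ε * (1 + δ) with hp
  have hppos : 0 < p := by positivity
  have hp1 : p ≤ 7 / 16 := by
    rw [hp]
    have : (1 + δ) ≤ 7 / 6 := by rw [hδ]; linarith
    nlinarith
  set μ : ℝ := (2 - p) / (2 * (1 - ε)) with hμ
  have h1ε : 0 < 1 - ε := by linarith
  have hμpos : 0 < μ := by rw [hμ]; exact div_pos (by linarith) (by linarith)
  refine eq_zero_of_mixed hV hK (T := T) le_rfl (lam := 1 - ε) (by linarith) (by linarith) hμpos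
    (κ := 1 / 2) (by norm_num) hδpos ?_ ?_
  · -- dissipation spent exactly: `2(1−ε)μ + ε·3(1+δ) = (2 − p) + p = 2`
    have e : 2 * (1 - ε) * μ + (1 - (1 - ε)) * (3 * (1 + δ) / (2 * (1 / 2))) = 2 := by
      rw [hμ, hp]; field_simp; ring
    rw [e]
  · -- contraction: `(1−ε)C²/μ + εT/8 < 1`
    have hC2 : C ^ 2 ≤ 1 := by nlinarith
    have hq : (1 - ε) * C ^ 2 / μ ≤ (1 - ε) / μ := by
      rw [mul_div_assoc]
      calc (1 - ε) * (C ^ 2 / μ) ≤ (1 - ε) * (1 / μ) := by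
            refine mul_le_mul_of_nonneg_left ?_ h1ε.le
            exact div_le_div_of_nonneg_right hC2 hμpos.le
        _ = (1 - ε) / μ := by ring
    have e1 : (1 - ε) / μ = 2 * (1 - ε) ^ 2 / (2 - p) := by
      rw [hμ]; field_simp
    have e2 : (1 - (1 - ε)) * (1 / 2) ^ 3 * T = ε * T / 8 := by ring
    rw [e2]
    have h2p : 0 < 2 - p := by linarith
    -- the key inequality `2(1−ε)² < (1 − εT/8)(2 − p)`, i.e. `(T/4 − 1) + 3δ + 2ε − Tp/8 < 0`
    have hkey : 2 * (1 - ε) ^ 2 / (2 - p) + ε * T / 8 < 1 := by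
      rw [div_add' _ _ _ h2p.ne', div_lt_one h2p]
      have hTp : 0 ≤ T * p := by positivity
      have hlin : T / 4 - 1 + 3 * δ + 2 * ε - T * p / 8 < 0 := by
        rw [hδ, hε, hg]
        nlinarith
      have hexp : 2 * (1 - ε) ^ 2 + ε * T / 8 * (2 - p) - (2 - p) =
          ε * (T / 4 - 1 + 3 * δ + 2 * ε - T * p / 8) := by
        rw [hp]; ring
      have := mul_neg_of_pos_of_neg hεpos hlin
      linarith
    linarith [hq, e1 ▸ hkey]

/-- **An explicit point of the lens with `C > 1` and `θ⁴ > 64/27` (i).** A member of `𝒟_{C,K}`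
with `C ≤ 21/20` and `θ(K)⁴ ≤ 5/2` vanishes identically (`λ = 9/25`, `μ = 763/1000`,
`κ = 53/80`, `δ = 1/1000`: the dissipation coefficient is `≤ 2` and the contraction ratio is
`< 0.986`). Neither strip of the tree contains this point (`C > 1`, `θ⁴ > 64/27 ≈ 2.370`).
[folklore energy method] -/
theorem eq_zero_of_typeI_le_of_theta_four_le₁ (hV : IsTypeIAncientMild C V) (hC1 : C ≤ 21 / 20)
    {K : ℝ}
    (hK : ∀ t : ℝ, t < 0 → ∫⁻ x, ‖fderiv ℝ (V t) x‖ₑ ^ 2 ≤ ENNReal.ofReal (K / Real.sqrt (-t)))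
    (hθ : (Real.sqrt (max K 0) * Real.sqrt (SNormLESNormFDerivOfEqConst (EuclideanSpace ℝ (Fin 3))
          (volume : Measure (EuclideanSpace ℝ (Fin 3))) 2 : ℝ) ^ 3) ^ 4 ≤ 5 / 2) :
    ∀ t < 0, ∀ x, V t x = 0 := by
  have hC : 0 ≤ C := hV.nonneg
  have hC2 : C ^ 2 ≤ (21 / 20) ^ 2 := pow_le_pow_left₀ hC hC1 2
  refine eq_zero_of_mixed hV hK hθ (lam := 9 / 25) (μ := 763 / 1000) (κ := 53 / 80)
    (δ := 1 / 1000) (by norm_num) (by norm_num) (by norm_num) (by norm_num) (by norm_num)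
    (by norm_num) ?_
  have : (9 / 25 : ℝ) * C ^ 2 / (763 / 1000) ≤ (9 / 25 : ℝ) * (21 / 20) ^ 2 / (763 / 1000) := by
    gcongr
  have hnum : (9 / 25 : ℝ) * (21 / 20) ^ 2 / (763 / 1000) + (1 - 9 / 25) * (53 / 80) ^ 3 * (5 / 2) < 1 := by
    norm_num
  linarith

/-- **An explicit point of the lens with `C > 1` and `θ⁴ > 64/27` (ii).** A member of `𝒟_{C,K}`
with `C ≤ 11/10` and `θ(K)⁴ ≤ 12/5` vanishes identically (`λ = 4/25`, `μ = 359/500`, `κ = 57/80`,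
`δ = 1/1000`). [folklore energy method] -/
theorem eq_zero_of_typeI_le_of_theta_four_le₂ (hV : IsTypeIAncientMild C V) (hC1 : C ≤ 11 / 10)
    {K : ℝ}
    (hK : ∀ t : ℝ, t < 0 → ∫⁻ x, ‖fderiv ℝ (V t) x‖ₑ ^ 2 ≤ ENNReal.ofReal (K / Real.sqrt (-t)))
    (hθ : (Real.sqrt (max K 0) * Real.sqrt (SNormLESNormFDerivOfEqConst (EuclideanSpace ℝ (Fin 3))
          (volume : Measure (EuclideanSpace ℝ (Fin 3))) 2 : ℝ) ^ 3) ^ 4 ≤ 12 / 5) :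
    ∀ t < 0, ∀ x, V t x = 0 := by
  have hC : 0 ≤ C := hV.nonneg
  have hC2 : C ^ 2 ≤ (11 / 10) ^ 2 := pow_le_pow_left₀ hC hC1 2
  refine eq_zero_of_mixed hV hK hθ (lam := 4 / 25) (μ := 359 / 500) (κ := 57 / 80)
    (δ := 1 / 1000) (by norm_num) (by norm_num) (by norm_num) (by norm_num) (by norm_num)
    (by norm_num) ?_
  have : (4 / 25 : ℝ) * C ^ 2 / (359 / 500) ≤ (4 / 25 : ℝ) * (11 / 10) ^ 2 / (359 / 500) := by
    gcongr
  have hnum : (4 / 25 : ℝ) * (11 / 10) ^ 2 / (359 / 500) + (1 - 4 / 25) * (57 / 80) ^ 3 * (12 / 5) < 1 := by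
    norm_num
  linarith

/-- **The explicit proved region of the crux, enlarged.** For all `C, K` and every `V ∈ 𝒟_{C,K}`:
membership in `{C ≤ 1 ∧ θ(K)⁴ < 4} ∪ {θ(K)⁴ < 64/27} ∪ {C ≤ 21/20 ∧ θ⁴ ≤ 5/2} ∪ {C ≤ 11/10 ∧ θ⁴ ≤ 12/5}`
excludes singularity at the apex (indeed forces `V ≡ 0`). Compare `…ProvedRegion.not_singular_of_explicit_region`
(`C ≤ 1 ∨ θ⁴ < 64/27`). -/
theorem not_singular_of_explicit_region₂ (hV : IsTypeIAncientMild C V) {K : ℝ}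
    (hK : ∀ t : ℝ, t < 0 → ∫⁻ x, ‖fderiv ℝ (V t) x‖ₑ ^ 2 ≤ ENNReal.ofReal (K / Real.sqrt (-t)))
    (h : (C ≤ 1 ∧ (Real.sqrt (max K 0) * Real.sqrt (SNormLESNormFDerivOfEqConst (EuclideanSpace ℝ (Fin 3))
          (volume : Measure (EuclideanSpace ℝ (Fin 3))) 2 : ℝ) ^ 3) ^ 4 < 4) ∨
      (Real.sqrt (max K 0) * Real.sqrt (SNormLESNormFDerivOfEqConst (EuclideanSpace ℝ (Fin 3))
          (volume : Measure (EuclideanSpace ℝ (Fin 3))) 2 : ℝ) ^ 3) ^ 4 < 64 / 27 ∨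
      (C ≤ 21 / 20 ∧ (Real.sqrt (max K 0) * Real.sqrt (SNormLESNormFDerivOfEqConst (EuclideanSpace ℝ (Fin 3))
          (volume : Measure (EuclideanSpace ℝ (Fin 3))) 2 : ℝ) ^ 3) ^ 4 ≤ 5 / 2) ∨
      (C ≤ 11 / 10 ∧ (Real.sqrt (max K 0) * Real.sqrt (SNormLESNormFDerivOfEqConst (EuclideanSpace ℝ (Fin 3))
          (volume : Measure (EuclideanSpace ℝ (Fin 3))) 2 : ℝ) ^ 3) ^ 4 ≤ 12 / 5)) :
    ¬ (∀ r > 0, ∀ M : ℝ, ∃ t ∈ Set.Ioo (-(r ^ 2)) (0 : ℝ),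
        ∃ x ∈ Metric.ball (0 : EuclideanSpace ℝ (Fin 3)) r, M < ‖V t x‖) := by
  have h0 : ∀ t < 0, ∀ x, V t x = 0 := by
    rcases h with ⟨hC1, hθ⟩ | hθ | ⟨hC1, hθ⟩ | ⟨hC1, hθ⟩
    · exact eq_zero_of_typeI_le_one_of_theta_four_lt_four hV hC1 hK hθ
    · exact eq_zero_of_small_dissipation_sharper hV hK hθ
    · exact eq_zero_of_typeI_le_of_theta_four_le₁ hV hC1 hK hθ
    · exact eq_zero_of_typeI_le_of_theta_four_le₂ hV hC1 hK hθ
  intro hsing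
  obtain ⟨t, ht, x, -, hM⟩ := hsing 1 one_pos 0
  rw [h0 t ht.2 x, norm_zero] at hM
  exact lt_irrefl _ hM

end Explicit

end Summit.NavierStokesRegularity.NavierStokesRegularity.Theorems.FiniteDissipationLiouville.MixedRegion

end
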